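import Literature.AlgebraicGeometry.Frobenioids.ArithmeticRealificationCoordinates
import Literature.AlgebraicGeometry.Frobenioids.RealificationPicLemmas
import Literature.AlgebraicGeometry.Frobenioids.ArithmeticDegreeRealification
import Literature.AlgebraicGeometry.Frobenioids.ModelFrobenioidBirat
import Literature.AlgebraicGeometry.Frobenioids.ArithmeticFrobenioidModel
import Literature.AlgebraicGeometry.Frobenioids.FrobenioidRealificationCanonical
import Literature.IUT.LogVolume.PrincipalArithmeticDivisorsSpan
import HarnessLib

/-!
# Frobenioids I, Thm. 6.4 (i), last sentence: `δ_A : Pic_Φ(A) ⥲ ℝ` is an isomorphism for THE realified arithmetic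
# Frobenioid `C_{K/F}^rlf`

Mochizuki, *The geometry of Frobenioids I*, Kyushu J. Math. **62** (2008), Thm. 6.4 (i) p. 114, last sentence:
"if `A` is a Frobenius-trivial object of `C^rlf` that projects to `Spec(L) ∈ Ob(D)`, then we have a natural
isomorphism of groups `δ_A : Pic_Φ(A) ⥲ ℝ` induced by `deg^arith_L` [cf. Theorem 5.1, (i)]", with its proof p. 115
l. 27–33: "`Pic_Φ(A)` may be identified with the quotient of `(Φ^rlf)^gp(L)` by the image of `Φ^birat(L) ⊗_ℤ ℝ`
… surjective formally … injective … a consequence of the well-known Dirichlet unit theorem"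
[cite: MochizukiFrdI2008, Thm. 6.4 (i) p.114] [cite: MochizukiFrdI2008, Thm. 6.4 (i) p.115].

PROOF-ONLY (node FrdI:Thm6.4(i), sub-DAG row T64i/L15 INTERFACE level, L1-lead R108 (3); seat abc-iut-L1-d2,
cell abc-iut).  Everything is at THE constructions: `Φ = arithDivisorFunctor F K` (Ex. 6.3), THE `Φ^birat` of
`C_{K/F}` = `PreFrobenioid.biratSubfunctor (ModelFrobenioid.toElem Φ B Div_B)` (= the image of `Div_B`, the principal
divisors: abc-iut-L1-d2 `ModelFrobenioid.biratSubfunctor_carrier_eq`), THE realification data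
`R = RealificationData.canonical Φ _` (Prop. 5.3), THE `Pic = (Φ^rlf)^gp(L) ⧸ (ℝ · Φ^birat)(L)`
(abc-iut-L1-t5 `GpSubfunctor.Pic` of `R.realSpan Φ^birat`, Thm. 5.1 (i)), and THE degree = the unique extension
`d : Φ(L)^rlf → ℝ_{≥0}` of `deg^arith_L` (`existsUnique_rlf_arithDegree`, p417348; here ANY `d` with that
restriction, hypothesis `hd`).  Results, for every perf-factoriality witness `hΦ` and every `X = Spec L`:
* `arith_exists_rlfDegree` — such a `d` exists;
* `arith_realSpan_le_ker` — `d^gp` kills `(ℝ · Φ^birat)(L)` (product formula `arithDegree_principalArithDivisor`,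
  abc-iut-L1-t3, through `RealificationData.canonical_realSpan_le_ker`), so `δ := ((ℝ_{≥0})^gp → ℝ) ∘ d^gp` DESCENDS
  to `Pic` (`arith_existsUnique_picDegree`, via `RealificationData.existsUnique_picLift`);
* `arith_picDegree_mk_iota` — on the class of `ι(D)`, `D ∈ Φ(L)`, the descended `δ` is `deg^arith_L(D)`;
* **`arith_picDegree_bijective`** — the descended `δ : Pic ⥲ ℝ` is BIJECTIVE: onto through the archimedean
  coordinate; injective = abc-iut-L1-t3's Dirichlet span `span_APrc_eq_ker_degF` (T64i/L14, p411355) transported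
  along the injective `ℝ`-linear coordinates `(Φ(L)^rlf)^gp ↪ ADiv_ℝ(L)` of `ArithRlfCoord.exists_rlfGp_coordinates`.
The `ArithRealification` instance (data) is assembled from these in `ArithmeticRealificationInstance.lean`.
-/

noncomputable section

open scoped NNReal

namespace Literature.AlgebraicGeometry.Frobenioids

open CategoryTheory Opposite Function NumberField IsDedekindDomain Literature.AnabelianGeometry.EtaleTheta
  Literature.IUT.LogVolume

namespace ArithRlfPic

variable {F : Type} [Field F] [NumberField F] {K : Type} [Field K] [Algebra F K]
  (hΦ : PreFrobenioid.IsPerfFactorialOn (arithDivisorFunctor F K)) (X : FinSubextCat F K)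

omit [NumberField F] in
/-- The elements of the rational function monoid `B(L) = L^×` of `C_{K/F}` are units (it is a group).
[cite: MochizukiFrdI2008, Ex. 6.3 p.113] -/
theorem isUnit_unitsFunctor (A : (FinSubextCat F K)ᵒᵖ) (b : (unitsFunctor F K).obj A) : IsUnit b := by
  change (A.unop.L)ˣ at b
  exact Group.isUnit b

/-! ### THE extension `d` of `deg^arith_L` to `Φ(L)^rlf` -/

/-- **THE degree on `Φ(L)^rlf`**: an (the, `existsUnique_rlf_arithDegree`) `ℝ_{≥0}`-valued homomorphism
`d : Φ(L)^rlf → ℝ_{≥0}` with `d(ι D) = deg^arith_L(D)` for every effective arithmetic divisor `D`.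
[cite: MochizukiFrdI2008, Thm. 6.4 (i) p.115] -/
theorem arith_exists_rlfDegree :
    ∃ d : (PreFrobenioid.IsPerfFactorialOn.op hΦ (op X)).Rlf →* Multiplicative ℝ≥0,
      ∀ D : EffArithDivisor X.L,
        ((Multiplicative.toAdd (d ((PreFrobenioid.IsPerfFactorialOn.op hΦ (op X)).toRealification
          (Perfection.of _ (Multiplicative.ofAdd D)))) : ℝ≥0) : ℝ) =
          arithDegree X.L (EffArithDivisor.toArithDivisor X.L D) := by
  obtain ⟨d₀, hd₀⟩ := exists_nnreal_arithDegree X.L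
  obtain ⟨d, hd, -⟩ := existsUnique_rlf_arithDegree X.L ArchFrd.Thm36Sub.supports_R_nnreal d₀
  refine ⟨d, fun D => ?_⟩
  rw [← hd₀ D, ← hd]
  rfl

variable (d : (PreFrobenioid.IsPerfFactorialOn.op hΦ (op X)).Rlf →* Multiplicative ℝ≥0)
  (hd : ∀ D : EffArithDivisor X.L,
    ((Multiplicative.toAdd (d ((PreFrobenioid.IsPerfFactorialOn.op hΦ (op X)).toRealification
      (Perfection.of _ (Multiplicative.ofAdd D)))) : ℝ≥0) : ℝ) =
      arithDegree X.L (EffArithDivisor.toArithDivisor X.L D))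

/-- `(ℝ_{≥0})^gp = ℝ` on generators: `[b] ↦ b` (the reading of `ℝ_{≥0}`-valued degrees in `ℝ`).
[cite: MochizukiFrdI2008, Thm. 6.4 (i) p.115] -/
theorem liftReal_of (b : Multiplicative ℝ≥0) :
    Algebra.GrothendieckGroup.lift
        (NNReal.toRealHom.toAddMonoidHom.toMultiplicative : Multiplicative ℝ≥0 →* Multiplicative ℝ)
        (Algebra.GrothendieckGroup.of b) =
      Multiplicative.ofAdd ((Multiplicative.toAdd b : ℝ≥0) : ℝ) :=
  DFunLike.congr_fun (Algebra.GrothendieckGroup.lift.symm_apply_apply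
    (NNReal.toRealHom.toAddMonoidHom.toMultiplicative : Multiplicative ℝ≥0 →* Multiplicative ℝ)) b

include hd

/-- `d` extends `deg^arith_L`, pointwise on `Φ(L)` (the hypothesis `hd`, for multiplicatively written `D`).
[cite: MochizukiFrdI2008, Ex. 6.3 p.113] -/
theorem toAdd_rlfDegree_iota (D : (arithDivisorFunctor F K).obj (op X)) :
    ((Multiplicative.toAdd (d ((PreFrobenioid.IsPerfFactorialOn.op hΦ (op X)).toRealification
      (Perfection.of _ D))) : ℝ≥0) : ℝ) =
      arithDegree X.L (EffArithDivisor.toArithDivisor X.L (Multiplicative.toAdd D)) := by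
  rw [← hd]
  rfl

/-- **Read in `ℝ`, the groupified degree `d^gp` on the image of `Φ(L)^gp` IS the arithmetic degree of Ex. 6.3**
(`Φ(L)^gp = ArithDivisor L` via `EffArithDivisor.gpHom`). [cite: MochizukiFrdI2008, Ex. 6.3 p.113] -/
theorem liftReal_map_toRlfGp (c : Algebra.GrothendieckGroup ((arithDivisorFunctor F K).obj (op X))) :
    Algebra.GrothendieckGroup.lift
        (NNReal.toRealHom.toAddMonoidHom.toMultiplicative : Multiplicative ℝ≥0 →* Multiplicative ℝ)
        (MonGp.map d
          ((RealificationData.canonical (arithDivisorFunctor F K) (PreFrobenioid.IsPerfFactorialOn.op hΦ)).toRlfGp X c)) =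
      (arithDegree X.L).toMultiplicative (EffArithDivisor.gpHom X.L c) := by
  -- both sides are homomorphisms `Φ(L)^gp → ℝ` agreeing on `Φ(L)`
  suffices h : ((Algebra.GrothendieckGroup.lift
        (NNReal.toRealHom.toAddMonoidHom.toMultiplicative : Multiplicative ℝ≥0 →* Multiplicative ℝ)).comp
        ((MonGp.map d).comp
          ((RealificationData.canonical (arithDivisorFunctor F K)
            (PreFrobenioid.IsPerfFactorialOn.op hΦ)).toRlfGp X))) =
      ((arithDegree X.L).toMultiplicative).comp (EffArithDivisor.gpHom X.L) from DFunLike.congr_fun h c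
  refine MonGp.hom_ext fun a => ?_
  show Algebra.GrothendieckGroup.lift _ (MonGp.map d ((RealificationData.canonical (arithDivisorFunctor F K)
      (PreFrobenioid.IsPerfFactorialOn.op hΦ)).toRlfGp X (Algebra.GrothendieckGroup.of a))) =
    (arithDegree X.L).toMultiplicative (EffArithDivisor.gpHom X.L (Algebra.GrothendieckGroup.of a))
  have h1 : (RealificationData.canonical (arithDivisorFunctor F K)
      (PreFrobenioid.IsPerfFactorialOn.op hΦ)).toRlfGp X (Algebra.GrothendieckGroup.of a) =
      Algebra.GrothendieckGroup.of ((PreFrobenioid.IsPerfFactorialOn.op hΦ (op X)).toRealification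
        (Perfection.of _ a)) := MonGp.map_of _ _
  have h2 : MonGp.map d (Algebra.GrothendieckGroup.of ((PreFrobenioid.IsPerfFactorialOn.op hΦ (op X)).toRealification
        (Perfection.of _ a))) =
      Algebra.GrothendieckGroup.of (d ((PreFrobenioid.IsPerfFactorialOn.op hΦ (op X)).toRealification
        (Perfection.of _ a))) := MonGp.map_of _ _
  rw [h1, h2, liftReal_of, toAdd_rlfDegree_iota hΦ X d hd, EffArithDivisor.gpHom_of,
    AddMonoidHom.toMultiplicative_apply_apply, toAdd_ofAdd]

/-! ### `d^gp` kills `ℝ · Φ^birat`: the degree descends to `Pic` -/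

/-- **`(ℝ · Φ^birat)(L) ⊆ ker d^gp`** at THE constructions: THE `Φ^birat` of `C_{K/F}` is the image of `Div_B`
(principal divisors), on which `deg^arith` vanishes (product formula), and `d^gp` is `ℝ`-linear
(`RealificationData.canonical_realSpan_le_ker`); hence `d^gp` factors through
`Pic = (Φ^rlf)^gp(L) ⧸ (ℝ · Φ^birat)(L)`. [cite: MochizukiFrdI2008, Thm. 6.4 (i) p.115] -/
theorem arith_realSpan_le_ker :
    ((RealificationData.canonical (arithDivisorFunctor F K) (PreFrobenioid.IsPerfFactorialOn.op hΦ)).realSpan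
        (PreFrobenioid.biratSubfunctor
          (ModelFrobenioid.toElem (arithDivisorFunctor F K) (unitsFunctor F K) (divNatTrans F K)))).carrier X ≤
      (MonGp.map d).ker := by
  refine RealificationData.canonical_realSpan_le_ker _ _ _ X ArchFrd.Thm36Sub.supports_R_nnreal d fun c hc => ?_
  rw [ModelFrobenioid.biratSubfunctor_carrier_eq (isUnit_unitsFunctor (F := F) (K := K)) X] at hc
  obtain ⟨f, rfl⟩ := hc
  -- through the injective `(ℝ_{≥0})^gp → ℝ` it suffices to compute the REAL degree of `div(f)`: `0`
  apply nnrealGp_lift_bijective.1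
  rw [map_one, liftReal_map_toRlfGp hΦ X d hd]
  show (arithDegree X.L).toMultiplicative (EffArithDivisor.gpHom X.L
    ((EffArithDivisor.gpEquiv X.L).symm (principalArithDivisorHom X.L f))) = 1
  rw [← EffArithDivisor.gpEquiv_apply, MulEquiv.apply_symm_apply, AddMonoidHom.toMultiplicative_apply_apply,
    arithDegree_comp_principalArithDivisorHom, ofAdd_zero]

/-- **THE descended degree exists uniquely**: there is a unique `δ : Pic → ℝ` (multiplicatively rendered) with
`δ ∘ (quotient map) = ((ℝ_{≥0})^gp → ℝ) ∘ d^gp`. [cite: MochizukiFrdI2008, Thm. 6.4 (i) p.115] -/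
theorem arith_existsUnique_picDegree :
    ∃! δ : ((RealificationData.canonical (arithDivisorFunctor F K) (PreFrobenioid.IsPerfFactorialOn.op hΦ)).realSpan
        (PreFrobenioid.biratSubfunctor
          (ModelFrobenioid.toElem (arithDivisorFunctor F K) (unitsFunctor F K) (divNatTrans F K)))).Pic X →*
        Multiplicative ℝ,
      δ.comp (QuotientGroup.mk' _) =
        (Algebra.GrothendieckGroup.lift
          (NNReal.toRealHom.toAddMonoidHom.toMultiplicative : Multiplicative ℝ≥0 →* Multiplicative ℝ)).comp
          (MonGp.map d) := by
  refine RealificationData.existsUnique_picLift _ _ X _ fun x hx => ?_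
  have hx' : MonGp.map d x = 1 := arith_realSpan_le_ker hΦ X d hd hx
  show Algebra.GrothendieckGroup.lift _ (MonGp.map d x) = 1
  rw [hx', map_one]

variable (δ : ((RealificationData.canonical (arithDivisorFunctor F K) (PreFrobenioid.IsPerfFactorialOn.op hΦ)).realSpan
        (PreFrobenioid.biratSubfunctor
          (ModelFrobenioid.toElem (arithDivisorFunctor F K) (unitsFunctor F K) (divNatTrans F K)))).Pic X →*
      Multiplicative ℝ)
  (hδ : δ.comp (QuotientGroup.mk' _) =
    (Algebra.GrothendieckGroup.lift
      (NNReal.toRealHom.toAddMonoidHom.toMultiplicative : Multiplicative ℝ≥0 →* Multiplicative ℝ)).comp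
      (MonGp.map d))
include hδ

omit hd in
/-- `δ` on the class of `[a]`, `a ∈ Φ(L)^rlf`, is `d(a)` read in `ℝ`. [cite: MochizukiFrdI2008, Thm. 6.4 (i) p.115] -/
theorem arith_picDegree_mk_of (a : (PreFrobenioid.IsPerfFactorialOn.op hΦ (op X)).Rlf) :
    δ (QuotientGroup.mk' _ (Algebra.GrothendieckGroup.of a)) =
      Multiplicative.ofAdd ((Multiplicative.toAdd (d a) : ℝ≥0) : ℝ) := by
  have h : δ (QuotientGroup.mk' _ (Algebra.GrothendieckGroup.of a)) =
      Algebra.GrothendieckGroup.lift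
        (NNReal.toRealHom.toAddMonoidHom.toMultiplicative : Multiplicative ℝ≥0 →* Multiplicative ℝ)
        (MonGp.map d (Algebra.GrothendieckGroup.of a)) := DFunLike.congr_fun hδ (Algebra.GrothendieckGroup.of a)
  have h2 : MonGp.map d (Algebra.GrothendieckGroup.of a) = Algebra.GrothendieckGroup.of (d a) := MonGp.map_of _ _
  rw [h, h2, liftReal_of]

/-- **`δ` on the class of `ι(D)` is `deg^arith_L(D)`** ("induced by `deg^arith_L`").
[cite: MochizukiFrdI2008, Thm. 6.4 (i) p.114] -/
theorem arith_picDegree_mk_iota (D : EffArithDivisor X.L) :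
    δ (QuotientGroup.mk' _ (Algebra.GrothendieckGroup.of
      ((PreFrobenioid.IsPerfFactorialOn.op hΦ (op X)).toRealification (Perfection.of _ (Multiplicative.ofAdd D))))) =
      Multiplicative.ofAdd (arithDegree X.L (EffArithDivisor.toArithDivisor X.L D)) := by
  rw [arith_picDegree_mk_of hΦ X d δ hδ, hd]

/-- **Every `t ≥ 0` is the degree of the class of an effective ARITHMETIC divisor**: the archimedean divisor
`(t/[L_w:ℝ]) · [w]` has `deg^arith = t` ("surjective formally"). [cite: MochizukiFrdI2008, Thm. 6.4 (i) p.115] -/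
theorem arith_exists_iota_picDegree_eq (t : ℝ) (ht : 0 ≤ t) :
    ∃ D : EffArithDivisor X.L, δ (QuotientGroup.mk' _ (Algebra.GrothendieckGroup.of
      ((PreFrobenioid.IsPerfFactorialOn.op hΦ (op X)).toRealification (Perfection.of _ (Multiplicative.ofAdd D))))) =
      Multiplicative.ofAdd t := by
  classical
  obtain ⟨w₀⟩ := (inferInstance : Nonempty (InfinitePlace X.L))
  have hm : (0 : ℝ) < w₀.mult := by exact_mod_cast (InfinitePlace.mult_pos (w := w₀))
  refine ⟨(0, Pi.single w₀ (t / w₀.mult).toNNReal), (arith_picDegree_mk_iota hΦ X d hd δ hδ _).trans ?_⟩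
  congr 1
  rw [arithDegree_apply]
  have h1 : (EffArithDivisor.toArithDivisor X.L
      ((0, Pi.single w₀ (t / w₀.mult).toNNReal) : EffArithDivisor X.L)).1 = 0 := by
    ext w
    rw [EffArithDivisor.toArithDivisor_fst]
    rfl
  rw [h1, Finsupp.sum_zero_index, zero_add, Finset.sum_eq_single w₀]
  · rw [EffArithDivisor.toArithDivisor_snd]
    show (w₀.mult : ℝ) * (((Pi.single w₀ (t / w₀.mult).toNNReal : InfinitePlace X.L → ℝ≥0) w₀ : ℝ≥0) : ℝ) = t
    rw [Pi.single_eq_same, Real.coe_toNNReal _ (div_nonneg ht hm.le), mul_div_cancel₀ _ hm.ne']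
  · intro w _ hw
    rw [EffArithDivisor.toArithDivisor_snd]
    show (w.mult : ℝ) * (((Pi.single w₀ (t / w₀.mult).toNNReal : InfinitePlace X.L → ℝ≥0) w : ℝ≥0) : ℝ) = 0
    rw [Pi.single_eq_of_ne hw, NNReal.coe_zero, mul_zero]
  · intro h
    exact absurd (Finset.mem_univ w₀) h

/-- **`δ` is onto** ("surjective formally"): by `arith_exists_iota_picDegree_eq` and inverses.
[cite: MochizukiFrdI2008, Thm. 6.4 (i) p.115] -/
theorem arith_picDegree_surjective : Surjective δ := by
  intro y
  rcases le_total 0 (Multiplicative.toAdd y) with hy | hy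
  · obtain ⟨D, hD⟩ := arith_exists_iota_picDegree_eq hΦ X d hd δ hδ _ hy
    exact ⟨_, by rw [hD, ofAdd_toAdd]⟩
  · obtain ⟨D, hD⟩ := arith_exists_iota_picDegree_eq hΦ X d hd δ hδ _ (neg_nonneg.mpr hy)
    exact ⟨_, by rw [map_inv, hD, ← ofAdd_neg, neg_neg, ofAdd_toAdd]⟩

/-- **`δ` is injective** ("a consequence of the well-known Dirichlet unit theorem"): through the injective `ℝ`-linear
coordinates `Θ : (Φ(L)^rlf)^gp ↪ ADiv_ℝ(L)` (`ArithRlfCoord.exists_rlfGp_coordinates`) the descended degree reads as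
`deg_L`, whose kernel is the `ℝ`-span of the principal divisors (abc-iut-L1-t3 `span_APrc_eq_ker_degF`), i.e. the
image under `Θ` of `(ℝ · Φ^birat)(L)`. [cite: MochizukiFrdI2008, Thm. 6.4 (i) p.115] -/
theorem arith_picDegree_injective : Injective δ := by
  -- THE perf-factoriality witness of `Φ(L)`, at the plain type (proof-irrelevant)
  have hM : IsPerfFactorial (Multiplicative (EffArithDivisor X.L)) := PreFrobenioid.IsPerfFactorialOn.op hΦ (op X)
  have hd' : ∀ D' : Multiplicative (EffArithDivisor X.L),
      ((Multiplicative.toAdd (d (hM.toRealification (Perfection.of _ D'))) : ℝ≥0) : ℝ) =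
        arithDegree X.L (EffArithDivisor.toArithDivisor X.L (Multiplicative.toAdd D')) :=
    fun D' => toAdd_rlfDegree_iota hΦ X d hd D'
  obtain ⟨Θ, hΘinj, hΘι, hΘeff, hΘlin⟩ := ArithRlfCoord.exists_rlfGp_coordinates hM
  -- (1) THE extension `d` read through `Θ`: `d(a) = deg_L(Θ [a])` for all `a ∈ Φ(L)^rlf`
  have hnn : ∀ a : hM.Rlf, 0 ≤ degF X.L (Multiplicative.toAdd (Θ (Algebra.GrothendieckGroup.of a))) :=
    fun a => degF_nonneg _ fun p => hΘeff a p
  let ψ : hM.Rlf →* Multiplicative ℝ≥0 :=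
    { toFun := fun a => Multiplicative.ofAdd (degF X.L (Multiplicative.toAdd (Θ (Algebra.GrothendieckGroup.of a)))).toNNReal
      map_one' := by
        rw [map_one, map_one, toAdd_one, map_zero, Real.toNNReal_zero, ofAdd_zero]
      map_mul' := fun a b => by
        rw [map_mul, map_mul, toAdd_mul, map_add, Real.toNNReal_add (hnn a) (hnn b), ofAdd_add] }
  have hψ : ∀ a : hM.Rlf, ((Multiplicative.toAdd (ψ a) : ℝ≥0) : ℝ) =
      degF X.L (Multiplicative.toAdd (Θ (Algebra.GrothendieckGroup.of a))) := fun a =>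
    Real.coe_toNNReal _ (hnn a)
  have hdψ : d = ψ := by
    have hu := IsPerfFactorial.Rlf.existsUnique_hom_extending hM ArchFrd.Thm36Sub.supports_R_nnreal
      (d.comp (hM.toRealification.comp (Perfection.of _)))
    refine hu.unique rfl (MonoidHom.ext fun D' => ?_)
    show ψ (hM.toRealification (Perfection.of _ D')) = d (hM.toRealification (Perfection.of _ D'))
    apply Multiplicative.toAdd.injective
    apply NNReal.coe_injective
    rw [hψ, hd', ← degF_ofArithDivisor]
    congr 1
    have h := hΘι (Multiplicative.toAdd D')
    rw [ofAdd_toAdd] at h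
    exact congrArg Multiplicative.toAdd h
  have hdeg : ∀ a : hM.Rlf, ((Multiplicative.toAdd (d a) : ℝ≥0) : ℝ) =
      degF X.L (Multiplicative.toAdd (Θ (Algebra.GrothendieckGroup.of a))) := fun a => by
    rw [hdψ]
    exact hψ a
  -- (2) `δ ∘ mk = deg_L ∘ Θ` on `(Φ(L)^rlf)^gp`
  have hδΘ : ∀ ξ, δ (QuotientGroup.mk' _ ξ) = Multiplicative.ofAdd (degF X.L (Multiplicative.toAdd (Θ ξ))) := by
    intro ξ
    suffices h : δ.comp (QuotientGroup.mk' _) = ((degF X.L).toAddMonoidHom.toMultiplicative).comp Θ from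
      DFunLike.congr_fun h ξ
    refine MonGp.hom_ext fun a => ?_
    show δ (QuotientGroup.mk' _ (Algebra.GrothendieckGroup.of a)) =
      (degF X.L).toAddMonoidHom.toMultiplicative (Θ (Algebra.GrothendieckGroup.of a))
    rw [arith_picDegree_mk_of hΦ X d δ hδ, hdeg, AddMonoidHom.toMultiplicative_apply_apply]
    rfl
  -- (3) `(ℝ · Φ^birat)(L)` is stable under the scalars, and the `ℝ`-span of the principal divisors lies in its
  -- image under `Θ`
  have hstab : ∀ (r : ℝ) (w : Algebra.GrothendieckGroup hM.Rlf),
      w ∈ ((RealificationData.canonical (arithDivisorFunctor F K) (PreFrobenioid.IsPerfFactorialOn.op hΦ)).realSpan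
        (PreFrobenioid.biratSubfunctor
          (ModelFrobenioid.toElem (arithDivisorFunctor F K) (unitsFunctor F K) (divNatTrans F K)))).carrier X →
      (RealificationData.canonical (arithDivisorFunctor F K) (PreFrobenioid.IsPerfFactorialOn.op hΦ)).rsmul X r w ∈
        ((RealificationData.canonical (arithDivisorFunctor F K) (PreFrobenioid.IsPerfFactorialOn.op hΦ)).realSpan
          (PreFrobenioid.biratSubfunctor
            (ModelFrobenioid.toElem (arithDivisorFunctor F K) (unitsFunctor F K) (divNatTrans F K)))).carrier X := by
    intro r w hw
    have hle : (Subgroup.closure ((RealificationData.canonical (arithDivisorFunctor F K)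
        (PreFrobenioid.IsPerfFactorialOn.op hΦ)).realSpanGen (PreFrobenioid.biratSubfunctor
          (ModelFrobenioid.toElem (arithDivisorFunctor F K) (unitsFunctor F K) (divNatTrans F K))) X)).map
        ((RealificationData.canonical (arithDivisorFunctor F K) (PreFrobenioid.IsPerfFactorialOn.op hΦ)).rsmul X r) ≤
        Subgroup.closure ((RealificationData.canonical (arithDivisorFunctor F K)
          (PreFrobenioid.IsPerfFactorialOn.op hΦ)).realSpanGen (PreFrobenioid.biratSubfunctor
            (ModelFrobenioid.toElem (arithDivisorFunctor F K) (unitsFunctor F K) (divNatTrans F K))) X) := by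
      rw [MonoidHom.map_closure]
      refine Subgroup.closure_mono ?_
      rintro _ ⟨x, ⟨s, c, hc, rfl⟩, rfl⟩
      exact ⟨r * s, c, hc, by rw [RealificationData.rsmul_mul]⟩
    exact hle (Subgroup.mem_map_of_mem _ hw)
  have hΘιgp : ∀ c : Algebra.GrothendieckGroup ((arithDivisorFunctor F K).obj (op X)),
      Θ ((RealificationData.canonical (arithDivisorFunctor F K) (PreFrobenioid.IsPerfFactorialOn.op hΦ)).toRlfGp X c) =
        (ADivisor.ofArithDivisor X.L).toMultiplicative (EffArithDivisor.gpHom X.L c) := by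
    intro c
    suffices h : Θ.comp ((RealificationData.canonical (arithDivisorFunctor F K)
        (PreFrobenioid.IsPerfFactorialOn.op hΦ)).toRlfGp X) =
        ((ADivisor.ofArithDivisor X.L).toMultiplicative).comp (EffArithDivisor.gpHom X.L) from DFunLike.congr_fun h c
    refine MonGp.hom_ext fun a => ?_
    show Θ ((RealificationData.canonical (arithDivisorFunctor F K) (PreFrobenioid.IsPerfFactorialOn.op hΦ)).toRlfGp X
      (Algebra.GrothendieckGroup.of a)) =
      (ADivisor.ofArithDivisor X.L).toMultiplicative (EffArithDivisor.gpHom X.L (Algebra.GrothendieckGroup.of a))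
    have h1 : (RealificationData.canonical (arithDivisorFunctor F K)
        (PreFrobenioid.IsPerfFactorialOn.op hΦ)).toRlfGp X (Algebra.GrothendieckGroup.of a) =
        Algebra.GrothendieckGroup.of (hM.toRealification (Perfection.of _ a)) := MonGp.map_of _ _
    have h2 := hΘι (Multiplicative.toAdd a)
    rw [ofAdd_toAdd] at h2
    rw [h1, EffArithDivisor.gpHom_of, AddMonoidHom.toMultiplicative_apply_apply, toAdd_ofAdd]
    exact h2
  have hspan : ∀ a ∈ Submodule.span ℝ ((APrc X.L : AddSubgroup (ADivisor X.L)) : Set (ADivisor X.L)),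
      Multiplicative.ofAdd a ∈ (((RealificationData.canonical (arithDivisorFunctor F K)
        (PreFrobenioid.IsPerfFactorialOn.op hΦ)).realSpan (PreFrobenioid.biratSubfunctor
          (ModelFrobenioid.toElem (arithDivisorFunctor F K) (unitsFunctor F K) (divNatTrans F K)))).carrier X).map Θ := by
    intro a ha
    induction ha using Submodule.span_induction with
    | mem a ha =>
      obtain ⟨f, hf, rfl⟩ := (mem_APrc_iff _).mp ha
      -- `principal f = Θ (ι^gp (Div_B (f)))`, and `ι^gp(Φ^birat) ⊆ ℝ · Φ^birat` (scalar `1`)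
      have hc : divB (arithDivisorFunctor F K) (unitsFunctor F K) (divNatTrans F K) (op X) (Units.mk0 f hf) ∈
          (PreFrobenioid.biratSubfunctor
            (ModelFrobenioid.toElem (arithDivisorFunctor F K) (unitsFunctor F K) (divNatTrans F K))).carrier X := by
        rw [ModelFrobenioid.biratSubfunctor_carrier_eq (isUnit_unitsFunctor (F := F) (K := K)) X]
        exact ⟨Units.mk0 f hf, rfl⟩
      refine ⟨(RealificationData.canonical (arithDivisorFunctor F K) (PreFrobenioid.IsPerfFactorialOn.op hΦ)).toRlfGp X
        (divB (arithDivisorFunctor F K) (unitsFunctor F K) (divNatTrans F K) (op X) (Units.mk0 f hf)), ?_, ?_⟩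
      · have h1 : (RealificationData.canonical (arithDivisorFunctor F K) (PreFrobenioid.IsPerfFactorialOn.op hΦ)).rsmul
            X 1 ((RealificationData.canonical (arithDivisorFunctor F K) (PreFrobenioid.IsPerfFactorialOn.op hΦ)).toRlfGp
              X (divB (arithDivisorFunctor F K) (unitsFunctor F K) (divNatTrans F K) (op X) (Units.mk0 f hf))) ∈
            ((RealificationData.canonical (arithDivisorFunctor F K) (PreFrobenioid.IsPerfFactorialOn.op hΦ)).realSpan
              (PreFrobenioid.biratSubfunctor
                (ModelFrobenioid.toElem (arithDivisorFunctor F K) (unitsFunctor F K) (divNatTrans F K)))).carrier X :=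
          Subgroup.subset_closure ⟨(1 : ℝ), _, hc, rfl⟩
        rw [RealificationData.rsmul_one] at h1
        exact h1
      · rw [hΘιgp]
        show (ADivisor.ofArithDivisor X.L).toMultiplicative (EffArithDivisor.gpHom X.L
          ((EffArithDivisor.gpEquiv X.L).symm (principalArithDivisorHom X.L (Units.mk0 f hf)))) = _
        rw [← EffArithDivisor.gpEquiv_apply, MulEquiv.apply_symm_apply, AddMonoidHom.toMultiplicative_apply_apply]
        show Multiplicative.ofAdd (ADivisor.ofArithDivisor X.L (principalArithDivisor X.L (Units.mk0 f hf))) = _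
        rw [ofArithDivisor_principalArithDivisor]
        rfl
    | zero => exact ⟨1, one_mem _, by rw [map_one, ofAdd_zero]⟩
    | add a b _ _ ha hb =>
      rw [ofAdd_add]
      exact mul_mem ha hb
    | smul r a _ ha =>
      obtain ⟨w, hw, hwa⟩ := ha
      refine ⟨_, hstab r w hw, ?_⟩
      rw [RealificationData.canonical_rsmul]
      erw [hΘlin r w]
      rw [hwa, toAdd_ofAdd]
  -- (4) conclusion
  rw [injective_iff_map_eq_one]
  intro q hq
  obtain ⟨ξ, rfl⟩ := QuotientGroup.mk'_surjective _ q
  have hdegξ : degF X.L (Multiplicative.toAdd (Θ ξ)) = 0 := by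
    have h := (hδΘ ξ).symm.trans hq
    rw [← ofAdd_zero] at h
    exact Multiplicative.ofAdd.injective h
  obtain ⟨w, hw, hwξ⟩ := hspan _ (mem_span_APrc_of_degF_eq_zero _ hdegξ)
  rw [ofAdd_toAdd] at hwξ
  rw [QuotientGroup.mk'_apply, QuotientGroup.eq_one_iff, ← hΘinj hwξ]
  exact hw

/-- **Theorem 6.4 (i), last sentence, at THE constructions: `δ_A : Pic_Φ(A) ⥲ ℝ` is an isomorphism** — THE degree of
THE realified arithmetic Frobenioid `C_{K/F}^rlf`, descended to THE `Pic = (Φ^rlf)^gp(L) ⧸ (ℝ · Φ^birat)(L)`, is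
bijective. [cite: MochizukiFrdI2008, Thm. 6.4 (i) p.114] -/
theorem arith_picDegree_bijective : Bijective δ :=
  ⟨arith_picDegree_injective hΦ X d hd δ hδ, arith_picDegree_surjective hΦ X d hd δ hδ⟩

end ArithRlfPic

end Literature.AlgebraicGeometry.Frobenioids

end
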